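import Summits.BirchSwinnertonDyer.BirchSwinnertonDyer.Theorems.TameQuarticSolventTprimeHodgeSplitAtThree
import Mathlib.NumberTheory.Padics.Hensel
import HarnessLib

/-!
# Route `TameQuarticSolvent`, crux `SolventPairLowerBound` (stmt-BirchSwinnertonDyer-21391) — `ℚ₃`-ROOTS OF THE
# `3`-DIVISION POLYNOMIAL on the medium form of a (t′) curve: exactly one in case A (Hensel), none in case B

HONEST FRAMING. Theorems only; helper (`--supports stmt-BirchSwinnertonDyer-21391 --as helper`) of width seat
bsd-wall-tqs-p1-w3 g5; third kernel file behind the memo `Cruxes/SolventPairLowerBound/TPRIME-LOCAL-SHAPE-w3g5.md`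
(census: `Ψ₃` has a `ℚ₃`-root on 13 935 / 13 935 case-A curves and on 0 / 1 381 case-B curves of the (t′) leaf,
`N < 5·10⁵`). With the tree's `hasIrreducibleModPGaloisRep_three_iff_forall_not_isRoot_Ψ₃` (Cremona §3.8) the
sequel file turns this into `LocIrr W 3 ⟺ case B` on the (t′) leaf — the local hypothesis of Fouquet–Wan 2021
Thm. 1.7 decided by `ord₃ c₆`. BSD is not proved by any of this; nothing here closes 21391.

WHAT (all for the `ℤ₃` MEDIUM FORM `S = y² = x³ + A₂x² + A₄x + A₆`, `Ψ₃ = 3x⁴ + 4A₂x³ + 6A₄x² + 12A₆x +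
(4A₂A₆ − A₄²)`):
* `eval_Ψ₃_eq`, `eval_Ψ₃_of_a₁_a₃_eq_zero`, `eval_Ψ₃_smul` (the `u⁸`-law of `Ψ₃` under `(u, r, s, t)`),
  `eval_Ψ₃_scale_three` (`Ψ₃^{(3A₂,9A₄,27A₆)}(3y) = 81·Ψ₃^{(A₂,A₄,A₆)}(y)`: `III* ↔ III`).
* CASE B, type `III` (`9 ∣ A₂`, `3 ∥ A₄`, `9 ∣ A₆`): `Ψ₃` has NO root in `ℚ₃`
  (`tprime_caseB_forall_eval_Ψ₃_ne_zero`): for `ord x < 0` the reversed value is `3 + 9(…)`, for `x ∈ ℤ₃ˣ`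
  the value is `≡ 3x⁴ (mod 9)`, for `3 ∣ x` it is `≡ −A₄² (mod 27)`.
* CASE A, type `III` (`3 ∥ A₂`, `3 ∣ A₄`, `9 ∣ A₆`): `Ψ₃` HAS a root in `ℤ₃` (`tprime_caseA_exists_eval_Ψ₃_eq_zero`):
  `Ψ₃ = 3g`, `g ≡ x³(x + A₂/3) (mod 3)`, and Hensel (Mathlib `PadicInt.hensels_lemma`) at the SIMPLE root
  `x ≡ −A₂/3` — this root is `x(H)`, `H` the canonical subgroup.
* the `III*` versions by `x = 3y`.

References: J. E. Cremona, *Algorithms for Modular Elliptic Curves* §3.8; J. H. Silverman, *AEC* III.1, Ex. 3.7;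
N. M. Katz, LNM 350 §3.1. [cite: SilvermanAEC2009, Exercise 3.7] [cite: Cremona1997, §3.8]
-/

-- D-0017: single-problem summit, so `Summit.BirchSwinnertonDyer.BirchSwinnertonDyer.…` repeats a namespace BY DESIGN.
set_option linter.dupNamespace false

noncomputable section

open IsLocalRing IsDedekindDomain Polynomial
open IsDiscreteValuationRing hiding maximalIdeal
open Literature Literature.NumberTheory.DiophantineGeometry
  Literature.NumberTheory.DiophantineGeometry.TateAlgorithm
  Literature.NumberTheory.EllipticCurves

namespace Summit.BirchSwinnertonDyer.BirchSwinnertonDyer.Theorems.SolventPairLowerBound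

/-! ## §1 Evaluating `Ψ₃` -/

section Eval

variable {R : Type*} [CommRing R]

/-- `Ψ₃(x) = 3x⁴ + b₂x³ + 3b₄x² + 3b₆x + b₈`. [cite: SilvermanAEC2009, Exercise 3.7] -/
theorem eval_Ψ₃_eq (W : WeierstrassCurve R) (x : R) :
    W.Ψ₃.eval x = 3 * x ^ 4 + W.b₂ * x ^ 3 + 3 * W.b₄ * x ^ 2 + 3 * W.b₆ * x + W.b₈ := by
  simp only [WeierstrassCurve.Ψ₃, eval_add, eval_mul, eval_C, eval_pow, eval_X, eval_ofNat]

/-- `Ψ₃` of a square-completed model: `Ψ₃(x) = 3x⁴ + 4a₂x³ + 6a₄x² + 12a₆x + (4a₂a₆ − a₄²)`.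
[cite: SilvermanAEC2009, Exercise 3.7] -/
theorem eval_Ψ₃_of_a₁_a₃_eq_zero (W : WeierstrassCurve R) (h₁ : W.a₁ = 0) (h₃ : W.a₃ = 0) (x : R) :
    W.Ψ₃.eval x = 3 * x ^ 4 + 4 * W.a₂ * x ^ 3 + 6 * W.a₄ * x ^ 2 + 12 * W.a₆ * x
      + (4 * W.a₂ * W.a₆ - W.a₄ ^ 2) := by
  rw [eval_Ψ₃_eq]
  simp only [WeierstrassCurve.b₂, WeierstrassCurve.b₄, WeierstrassCurve.b₆, WeierstrassCurve.b₈, h₁, h₃]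
  ring

/-- **The `u⁸`-law of `Ψ₃` under a change of variables** `(u, r, s, t)`:
`Ψ₃^{C•W}(x) = u⁻⁸ · Ψ₃^{W}(u²x + r)` (the roots of `Ψ₃` are the `x`-coordinates of the points of order `3`,
and `x = u²x' + r`). [cite: SilvermanAEC2009, III.1 and Exercise 3.7] -/
theorem eval_Ψ₃_smul (C : WeierstrassCurve.VariableChange R) (W : WeierstrassCurve R) (x : R) :
    (C • W).Ψ₃.eval x = (C.u⁻¹ : Rˣ) ^ 8 * W.Ψ₃.eval ((C.u : R) ^ 2 * x + C.r) := by
  rw [eval_Ψ₃_eq, eval_Ψ₃_eq, WeierstrassCurve.variableChange_b₂, WeierstrassCurve.variableChange_b₄,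
    WeierstrassCurve.variableChange_b₆, WeierstrassCurve.variableChange_b₈]
  have hu : (C.u : R) * (C.u⁻¹ : Rˣ) = 1 := C.u.mul_inv
  set u : R := (C.u : R) with hudef
  set v : R := ((C.u⁻¹ : Rˣ) : R) with hvdef
  linear_combination (-(x * (3 * W.b₂ * C.r ^ 2 + 6 * C.r * W.b₄ + 12 * C.r ^ 3 + 3 * W.b₆) * v ^ 6
      * (1 + u * v)
    + x ^ 2 * (3 * W.b₂ * C.r + 18 * C.r ^ 2 + 3 * W.b₄) * v ^ 4
      * (1 + u * v + (u * v) ^ 2 + (u * v) ^ 3)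
    + x ^ 3 * (W.b₂ + 12 * C.r) * v ^ 2
      * (1 + u * v + (u * v) ^ 2 + (u * v) ^ 3 + (u * v) ^ 4 + (u * v) ^ 5)
    + 3 * x ^ 4 * (1 + u * v + (u * v) ^ 2 + (u * v) ^ 3 + (u * v) ^ 4 + (u * v) ^ 5 + (u * v) ^ 6
      + (u * v) ^ 7))) * hu

/-- **`III* ↔ III` for `Ψ₃`.** If `S = (3A₂, 9A₄, 27A₆)` and `S° = (A₂, A₄, A₆)` are square-completed models then
`Ψ₃^{S}(3y) = 81·Ψ₃^{S°}(y)` (the change `x = 3y`, i.e. `(u, r) = (√3, 0)` squared away). [folklore] -/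
theorem eval_Ψ₃_scale_three (S T : WeierstrassCurve R) (hS₁ : S.a₁ = 0) (hS₃ : S.a₃ = 0) (hT₁ : T.a₁ = 0)
    (hT₃ : T.a₃ = 0) (h₂ : S.a₂ = 3 * T.a₂) (h₄ : S.a₄ = 9 * T.a₄) (h₆ : S.a₆ = 27 * T.a₆) (y : R) :
    S.Ψ₃.eval (3 * y) = 81 * T.Ψ₃.eval y := by
  rw [eval_Ψ₃_of_a₁_a₃_eq_zero S hS₁ hS₃, eval_Ψ₃_of_a₁_a₃_eq_zero T hT₁ hT₃, h₂, h₄, h₆]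
  ring

/-- **Reversing `Ψ₃`.** In a field, for `x·y = 1`:
`Ψ₃(x) = x⁴·(3 + b₂y + 3b₄y² + 3b₆y³ + b₈y⁴)`. [folklore] -/
theorem eval_Ψ₃_eq_mul_reverse {F : Type*} [Field F] (W : WeierstrassCurve F) {x y : F} (hxy : x * y = 1) :
    W.Ψ₃.eval x = x ^ 4 * (3 + W.b₂ * y + 3 * W.b₄ * y ^ 2 + 3 * W.b₆ * y ^ 3 + W.b₈ * y ^ 4) := by
  rw [eval_Ψ₃_eq]
  linear_combination (-(W.b₂ * x ^ 3 + 3 * W.b₄ * x ^ 2 * (x * y + 1)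
    + 3 * W.b₆ * x * (x ^ 2 * y ^ 2 + x * y + 1) + W.b₈ * (x ^ 3 * y ^ 3 + x ^ 2 * y ^ 2 + x * y + 1))) * hxy

end Eval

/-! ## §2 Case B of type `III`: no root of `Ψ₃` in `ℚ₃` -/

section CaseB

/-- **Case B, `III`, integral points.** For the `ℤ₃` medium form with `9 ∣ A₂`, `3 ∥ A₄`, `9 ∣ A₆`:
`Ψ₃(z) ≠ 0` for every `z ∈ ℤ₃` (`z` a unit: `Ψ₃(z) ≡ 3z⁴ (mod 9)`; `3 ∣ z`: `Ψ₃(z) ≡ −A₄² (mod 27)`).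
[cite: SilvermanAEC2009, Exercise 3.7] -/
theorem tprime_caseB_eval_Ψ₃_ne_zero_padicInt (S : WeierstrassCurve ℤ_[3]) (h₁ : S.a₁ = 0) (h₃ : S.a₃ = 0)
    (h₂ : (3 : ℤ_[3]) ^ 2 ∣ S.a₂) (h₄ : (3 : ℤ_[3]) ∣ S.a₄) (h₄' : ¬ (3 : ℤ_[3]) ^ 2 ∣ S.a₄)
    (h₆ : (3 : ℤ_[3]) ^ 2 ∣ S.a₆) (z : ℤ_[3]) : S.Ψ₃.eval z ≠ 0 := by
  have h3 : Irreducible (3 : ℤ_[3]) := by simpa using PadicInt.irreducible_p (p := 3)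
  have hprime : Prime (3 : ℤ_[3]) := by simpa using PadicInt.prime_p (p := 3)
  obtain ⟨s, hs⟩ := h₂
  obtain ⟨t, ht⟩ := h₄
  obtain ⟨w, hw⟩ := h₆
  have ht3 : ¬ (3 : ℤ_[3]) ∣ t := by
    rintro ⟨t', rfl⟩
    exact h₄' ⟨t', by rw [ht]; ring⟩
  rw [eval_Ψ₃_of_a₁_a₃_eq_zero S h₁ h₃, hs, ht, hw]
  intro h0
  by_cases hz : (3 : ℤ_[3]) ∣ z
  · -- `3 ∣ z`: the value is `9·(3·(…) − t²)`
    obtain ⟨z', rfl⟩ := hz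
    have key : (9 : ℤ_[3]) * (3 * (9 * z' ^ 4 + 36 * s * z' ^ 3 + 6 * t * z' ^ 2 + 12 * w * z'
        + 12 * s * w) - t ^ 2) = 0 := by
      linear_combination h0
    have h9 : (9 : ℤ_[3]) ≠ 0 := by norm_num
    have key' := (mul_eq_zero.mp key).resolve_left h9
    apply ht3
    have : (3 : ℤ_[3]) ∣ t ^ 2 := ⟨9 * z' ^ 4 + 36 * s * z' ^ 3 + 6 * t * z' ^ 2 + 12 * w * z'
        + 12 * s * w, by linear_combination -key'⟩
    exact hprime.dvd_of_dvd_pow this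
  · -- `z` a unit: the value is `3·(z⁴ + 3·(…))`
    have key : (3 : ℤ_[3]) * (z ^ 4 + 3 * (4 * s * z ^ 3 + 2 * t * z ^ 2 + 12 * w * z + 36 * s * w
        - t ^ 2)) = 0 := by
      linear_combination h0
    have key' := (mul_eq_zero.mp key).resolve_left h3.ne_zero
    apply hz
    have : (3 : ℤ_[3]) ∣ z ^ 4 := ⟨-(4 * s * z ^ 3 + 2 * t * z ^ 2 + 12 * w * z + 36 * s * w - t ^ 2),
      by linear_combination key'⟩
    exact hprime.dvd_of_dvd_pow this

/-- **Case B, `III`, the reversed polynomial.** Same hypotheses: `3 + b₂z + 3b₄z² + 3b₆z³ + b₈z⁴ ≠ 0` for every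
`z ∈ 3ℤ₃` (it is `≡ 3 (mod 9)`). [folklore] -/
theorem tprime_caseB_reverse_ne_zero_padicInt (S : WeierstrassCurve ℤ_[3]) (h₁ : S.a₁ = 0) (h₃ : S.a₃ = 0)
    (h₂ : (3 : ℤ_[3]) ^ 2 ∣ S.a₂) (h₄ : (3 : ℤ_[3]) ∣ S.a₄) (h₆ : (3 : ℤ_[3]) ^ 2 ∣ S.a₆) {z : ℤ_[3]}
    (hz : (3 : ℤ_[3]) ∣ z) :
    3 + S.b₂ * z + 3 * S.b₄ * z ^ 2 + 3 * S.b₆ * z ^ 3 + S.b₈ * z ^ 4 ≠ 0 := by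
  have h3 : Irreducible (3 : ℤ_[3]) := by simpa using PadicInt.irreducible_p (p := 3)
  obtain ⟨s, hs⟩ := h₂
  obtain ⟨t, ht⟩ := h₄
  obtain ⟨w, hw⟩ := h₆
  obtain ⟨z', rfl⟩ := hz
  simp only [WeierstrassCurve.b₂, WeierstrassCurve.b₄, WeierstrassCurve.b₆, WeierstrassCurve.b₈, h₁, h₃, hs,
    ht, hw]
  intro h0
  have key : (3 : ℤ_[3]) * (1 + 3 * (12 * s * z' + 18 * t * z' ^ 2 + 324 * w * z' ^ 3
      + 81 * (36 * s * w - t ^ 2) * z' ^ 4)) = 0 := by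
    linear_combination h0
  have key' := (mul_eq_zero.mp key).resolve_left h3.ne_zero
  apply h3.not_isUnit
  exact isUnit_of_dvd_one ⟨-(12 * s * z' + 18 * t * z' ^ 2 + 324 * w * z' ^ 3
      + 81 * (36 * s * w - t ^ 2) * z' ^ 4), by linear_combination key'⟩

/-- **Case B, `III`: `Ψ₃` has no root in `ℚ₃`.** For the `ℤ₃` medium form `S` with `9 ∣ A₂`, `3 ∥ A₄`,
`9 ∣ A₆`, the `3`-division polynomial of `S ⊗ ℚ₃` has no root in `ℚ₃` (integral `x`:
`tprime_caseB_eval_Ψ₃_ne_zero_padicInt`; `ord x < 0`: reverse the polynomial). [cite: Cremona1997, §3.8] -/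
theorem tprime_caseB_forall_eval_Ψ₃_ne_zero (S : WeierstrassCurve ℤ_[3]) (h₁ : S.a₁ = 0) (h₃ : S.a₃ = 0)
    (h₂ : (3 : ℤ_[3]) ^ 2 ∣ S.a₂) (h₄ : (3 : ℤ_[3]) ∣ S.a₄) (h₄' : ¬ (3 : ℤ_[3]) ^ 2 ∣ S.a₄)
    (h₆ : (3 : ℤ_[3]) ^ 2 ∣ S.a₆) (x : ℚ_[3]) :
    (S.map (algebraMap ℤ_[3] ℚ_[3])).Ψ₃.eval x ≠ 0 := by
  have hinj : Function.Injective (algebraMap ℤ_[3] ℚ_[3]) := IsFractionRing.injective ℤ_[3] ℚ_[3]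
  by_cases hx : ‖x‖ ≤ 1
  · -- integral `x`
    set z : ℤ_[3] := ⟨x, hx⟩ with hz
    have hxz : x = algebraMap ℤ_[3] ℚ_[3] z := rfl
    rw [hxz, WeierstrassCurve.map_Ψ₃, eval_map, eval₂_hom]
    exact fun h ↦ tprime_caseB_eval_Ψ₃_ne_zero_padicInt S h₁ h₃ h₂ h₄ h₄' h₆ z
      ((injective_iff_map_eq_zero _).mp hinj _ h)
  · -- `‖x‖ > 1`: reverse
    rw [not_le] at hx
    have hx0 : x ≠ 0 := by
      rintro rfl
      rw [norm_zero] at hx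
      exact absurd hx (by norm_num)
    have hy : ‖x⁻¹‖ ≤ 1 := by
      rw [norm_inv]; exact inv_le_one_of_one_le₀ hx.le
    set z : ℤ_[3] := ⟨x⁻¹, hy⟩ with hz
    have hz3 : (3 : ℤ_[3]) ∣ z := by
      have : ‖z‖ < 1 := by
        change ‖x⁻¹‖ < 1
        rw [norm_inv]; exact inv_lt_one_of_one_lt₀ hx
      simpa using (PadicInt.norm_lt_one_iff_dvd z).mp this
    have hxy : x * (algebraMap ℤ_[3] ℚ_[3] z) = 1 := by
      change x * x⁻¹ = 1
      exact mul_inv_cancel₀ hx0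
    rw [eval_Ψ₃_eq_mul_reverse _ hxy]
    refine mul_ne_zero (pow_ne_zero _ hx0) ?_
    have h := tprime_caseB_reverse_ne_zero_padicInt S h₁ h₃ h₂ h₄ h₆ hz3
    have e : (3 + (S.map (algebraMap ℤ_[3] ℚ_[3])).b₂ * algebraMap ℤ_[3] ℚ_[3] z
        + 3 * (S.map (algebraMap ℤ_[3] ℚ_[3])).b₄ * algebraMap ℤ_[3] ℚ_[3] z ^ 2
        + 3 * (S.map (algebraMap ℤ_[3] ℚ_[3])).b₆ * algebraMap ℤ_[3] ℚ_[3] z ^ 3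
        + (S.map (algebraMap ℤ_[3] ℚ_[3])).b₈ * algebraMap ℤ_[3] ℚ_[3] z ^ 4)
        = algebraMap ℤ_[3] ℚ_[3] (3 + S.b₂ * z + 3 * S.b₄ * z ^ 2 + 3 * S.b₆ * z ^ 3 + S.b₈ * z ^ 4) := by
      simp only [WeierstrassCurve.map_b₂, WeierstrassCurve.map_b₄, WeierstrassCurve.map_b₆,
        WeierstrassCurve.map_b₈, map_add, map_mul, map_pow, map_ofNat]
    rw [e]
    exact fun h0 ↦ h ((injective_iff_map_eq_zero _).mp hinj _ h0)

end CaseB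

/-! ## §3 Case A of type `III`: a root of `Ψ₃` in `ℤ₃` (Hensel at the canonical subgroup) -/

section CaseA

/-- **Case A, `III`: `Ψ₃` has a root in `ℤ₃`.** For the `ℤ₃` medium form with `3 ∥ A₂` (`A₂ = 3s`, `s ∈ ℤ₃ˣ`),
`3 ∣ A₄`, `9 ∣ A₆`: `Ψ₃ = 3·g` with `g = x⁴ + 4sx³ + 6tx² + 36wx + (36sw − 3t²) ≡ x³(x + s) (mod 3)`;
`g(−s) = −3(s² − t)²`, `g′(−s) = 8s³ − 12ts + 36w ∈ ℤ₃ˣ`, so Hensel's lemma (Mathlib `PadicInt.hensels_lemma`)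
gives a root `x_H ≡ −s (mod 3)` — the `x`-coordinate of the canonical subgroup. [cite: Cremona1997, §3.8] -/
theorem tprime_caseA_exists_eval_Ψ₃_eq_zero (S : WeierstrassCurve ℤ_[3]) (h₁ : S.a₁ = 0) (h₃ : S.a₃ = 0)
    (h₂ : (3 : ℤ_[3]) ∣ S.a₂) (h₂' : ¬ (3 : ℤ_[3]) ^ 2 ∣ S.a₂) (h₄ : (3 : ℤ_[3]) ∣ S.a₄)
    (h₆ : (3 : ℤ_[3]) ^ 2 ∣ S.a₆) : ∃ z : ℤ_[3], S.Ψ₃.eval z = 0 := by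
  have h3 : Irreducible (3 : ℤ_[3]) := by simpa using PadicInt.irreducible_p (p := 3)
  have hprime : Prime (3 : ℤ_[3]) := by simpa using PadicInt.prime_p (p := 3)
  obtain ⟨s, hs⟩ := h₂
  obtain ⟨t, ht⟩ := h₄
  obtain ⟨w, hw⟩ := h₆
  have hs3 : ¬ (3 : ℤ_[3]) ∣ s := by
    rintro ⟨s', rfl⟩
    exact h₂' ⟨s', by rw [hs]; ring⟩
  set g : ℤ_[3][X] := X ^ 4 + C (4 * s) * X ^ 3 + C (6 * t) * X ^ 2 + C (36 * w) * X
    + C (36 * s * w - 3 * t ^ 2) with hg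
  have hg_eval : ∀ x : ℤ_[3], g.eval x = x ^ 4 + 4 * s * x ^ 3 + 6 * t * x ^ 2 + 36 * w * x
      + (36 * s * w - 3 * t ^ 2) := fun x ↦ by
    simp only [hg, eval_add, eval_mul, eval_C, eval_pow, eval_X]
  have hΨ : ∀ x : ℤ_[3], S.Ψ₃.eval x = 3 * g.eval x := fun x ↦ by
    rw [eval_Ψ₃_of_a₁_a₃_eq_zero S h₁ h₃, hs, ht, hw, hg_eval]
    ring
  have hg'_eval : g.derivative.eval (-s) = 8 * s ^ 3 + 3 * (-(4 * t * s) + 12 * w) := by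
    simp only [hg, derivative_add, derivative_mul, derivative_C, derivative_X_pow, derivative_X, eval_add,
      eval_mul, eval_C, eval_pow, eval_X, zero_mul, zero_add, add_zero, mul_one, Nat.cast_ofNat]
    norm_num
    ring
  have hga : g.eval (-s) = 3 * (-(s ^ 2 - t) ^ 2) := by
    rw [hg_eval]
    ring
  -- the Hensel condition
  have hunit : IsUnit (g.derivative.eval (-s)) := by
    rw [hg'_eval, isUnit_iff_not_dvd h3]
    rintro ⟨m, hm⟩
    apply hs3
    have h8 : (3 : ℤ_[3]) ∣ 8 * s ^ 3 := ⟨m - (-(4 * t * s) + 12 * w), by linear_combination hm⟩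
    rcases hprime.dvd_or_dvd h8 with h8' | hs'
    · exfalso
      have h9 : (3 : ℤ_[3]) ∣ 9 := ⟨3, by norm_num⟩
      have h1 : (3 : ℤ_[3]) ∣ 9 - 8 := dvd_sub h9 h8'
      norm_num at h1
      exact h3.not_isUnit (isUnit_of_dvd_one h1)
    · exact hprime.dvd_of_dvd_pow hs'
  have hnorm : ‖g.aeval (-s)‖ < ‖g.derivative.aeval (-s)‖ ^ 2 := by
    change ‖g.eval (-s)‖ < ‖g.derivative.eval (-s)‖ ^ 2
    rw [PadicInt.isUnit_iff.mp hunit, one_pow, PadicInt.norm_lt_one_iff_dvd, hga]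
    exact ⟨-(s ^ 2 - t) ^ 2, by push_cast; ring⟩
  obtain ⟨z, hz, -⟩ := hensels_lemma hnorm
  refine ⟨z, ?_⟩
  have hz' : g.eval z = 0 := hz
  rw [hΨ, hz', mul_zero]

/-- **Case A, `III`, over `ℚ₃`.** The root of `tprime_caseA_exists_eval_Ψ₃_eq_zero`, read in `ℚ₃`. [folklore] -/
theorem tprime_caseA_exists_eval_Ψ₃_eq_zero_padic (S : WeierstrassCurve ℤ_[3]) (h₁ : S.a₁ = 0) (h₃ : S.a₃ = 0)
    (h₂ : (3 : ℤ_[3]) ∣ S.a₂) (h₂' : ¬ (3 : ℤ_[3]) ^ 2 ∣ S.a₂) (h₄ : (3 : ℤ_[3]) ∣ S.a₄)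
    (h₆ : (3 : ℤ_[3]) ^ 2 ∣ S.a₆) : ∃ x : ℚ_[3], (S.map (algebraMap ℤ_[3] ℚ_[3])).Ψ₃.eval x = 0 := by
  obtain ⟨z, hz⟩ := tprime_caseA_exists_eval_Ψ₃_eq_zero S h₁ h₃ h₂ h₂' h₄ h₆
  exact ⟨algebraMap ℤ_[3] ℚ_[3] z, by rw [WeierstrassCurve.map_Ψ₃, eval_map, eval₂_hom, hz, map_zero]⟩

end CaseA

/-! ## §4 Type `III*` by the rescaling `x = 3y` -/

section IIIstar

/-- **Case B, `III*`: `Ψ₃` has no root in `ℚ₃`.** For the `ℤ₃` medium form of type `III*` with `27 ∣ A₂`,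
`27 ∥ A₄`, `3⁵ ∣ A₆`: no root of `Ψ₃` in `ℚ₃` (rescale to the `III` form `(A₂/3, A₄/9, A₆/27)`, which is in case B).
[cite: Cremona1997, §3.8] -/
theorem tprime_caseB_forall_eval_Ψ₃_ne_zero_IIIstar (S : WeierstrassCurve ℤ_[3]) (h₁ : S.a₁ = 0)
    (h₃ : S.a₃ = 0) (h₂ : (3 : ℤ_[3]) ^ 3 ∣ S.a₂) (h₄ : (3 : ℤ_[3]) ^ 3 ∣ S.a₄)
    (h₄' : ¬ (3 : ℤ_[3]) ^ 4 ∣ S.a₄) (h₆ : (3 : ℤ_[3]) ^ 5 ∣ S.a₆) (x : ℚ_[3]) :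
    (S.map (algebraMap ℤ_[3] ℚ_[3])).Ψ₃.eval x ≠ 0 := by
  obtain ⟨s, hs⟩ := h₂
  obtain ⟨t, ht⟩ := h₄
  obtain ⟨w, hw⟩ := h₆
  set T : WeierstrassCurve ℤ_[3] := ⟨0, 9 * s, 0, 3 * t, 9 * w⟩ with hT
  have hT₂ : (3 : ℤ_[3]) ^ 2 ∣ T.a₂ := ⟨s, by rw [hT]; ring⟩
  have hT₄ : (3 : ℤ_[3]) ∣ T.a₄ := ⟨t, by rw [hT]⟩
  have hT₄' : ¬ (3 : ℤ_[3]) ^ 2 ∣ T.a₄ := by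
    rintro ⟨t', ht'⟩
    apply h₄'
    refine ⟨t', ?_⟩
    rw [ht]
    have : (3 : ℤ_[3]) * t = 3 ^ 2 * t' := ht'
    linear_combination 9 * this
  have hT₆ : (3 : ℤ_[3]) ^ 2 ∣ T.a₆ := ⟨w, by rw [hT]; ring⟩
  set ι := algebraMap ℤ_[3] ℚ_[3] with hι
  have hscale : (S.map ι).Ψ₃.eval (3 * (x / 3)) = 81 * (T.map ι).Ψ₃.eval (x / 3) :=
    eval_Ψ₃_scale_three (S.map ι) (T.map ι) (by simp [WeierstrassCurve.map_a₁, h₁])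
      (by simp [WeierstrassCurve.map_a₃, h₃]) (by simp [WeierstrassCurve.map_a₁, hT])
      (by simp [WeierstrassCurve.map_a₃, hT])
      (by simp only [WeierstrassCurve.map_a₂, hs, hT, map_mul, map_pow, map_ofNat]; ring)
      (by simp only [WeierstrassCurve.map_a₄, ht, hT, map_mul, map_pow, map_ofNat]; ring)
      (by simp only [WeierstrassCurve.map_a₆, hw, hT, map_mul, map_pow, map_ofNat]; ring) (x / 3)
  rw [mul_div_cancel₀ x (by norm_num : (3 : ℚ_[3]) ≠ 0)] at hscale
  rw [hscale]
  exact mul_ne_zero (by norm_num)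
    (tprime_caseB_forall_eval_Ψ₃_ne_zero T rfl rfl hT₂ hT₄ hT₄' hT₆ (x / 3))

/-- **Case A, `III*`: `Ψ₃` has a root in `ℚ₃`.** For the `ℤ₃` medium form of type `III*` with `9 ∥ A₂`,
`27 ∣ A₄`, `3⁵ ∣ A₆`: a root of `Ψ₃` in `ℚ₃` (indeed in `3ℤ₃`: `x = 3z`, `z` the Hensel root of the `III` form
`(A₂/3, A₄/9, A₆/27)`, which is in case A). [cite: Cremona1997, §3.8] -/
theorem tprime_caseA_exists_eval_Ψ₃_eq_zero_IIIstar (S : WeierstrassCurve ℤ_[3]) (h₁ : S.a₁ = 0)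
    (h₃ : S.a₃ = 0) (h₂ : (3 : ℤ_[3]) ^ 2 ∣ S.a₂) (h₂' : ¬ (3 : ℤ_[3]) ^ 3 ∣ S.a₂)
    (h₄ : (3 : ℤ_[3]) ^ 3 ∣ S.a₄) (h₆ : (3 : ℤ_[3]) ^ 5 ∣ S.a₆) :
    ∃ x : ℚ_[3], (S.map (algebraMap ℤ_[3] ℚ_[3])).Ψ₃.eval x = 0 := by
  obtain ⟨s, hs⟩ := h₂
  obtain ⟨t, ht⟩ := h₄
  obtain ⟨w, hw⟩ := h₆
  set T : WeierstrassCurve ℤ_[3] := ⟨0, 3 * s, 0, 3 * t, 9 * w⟩ with hT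
  have hT₂ : (3 : ℤ_[3]) ∣ T.a₂ := ⟨s, by rw [hT]⟩
  have hT₂' : ¬ (3 : ℤ_[3]) ^ 2 ∣ T.a₂ := by
    rintro ⟨s', hs'⟩
    apply h₂'
    refine ⟨s', ?_⟩
    rw [hs]
    have : (3 : ℤ_[3]) * s = 3 ^ 2 * s' := hs'
    linear_combination 3 * this
  have hT₄ : (3 : ℤ_[3]) ∣ T.a₄ := ⟨t, by rw [hT]⟩
  have hT₆ : (3 : ℤ_[3]) ^ 2 ∣ T.a₆ := ⟨w, by rw [hT]; ring⟩
  obtain ⟨z, hz⟩ := tprime_caseA_exists_eval_Ψ₃_eq_zero T rfl rfl hT₂ hT₂' hT₄ hT₆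
  have hscale : S.Ψ₃.eval (3 * z) = 81 * T.Ψ₃.eval z :=
    eval_Ψ₃_scale_three S T h₁ h₃ rfl rfl (by rw [hs, hT]; ring) (by rw [ht, hT]; ring)
      (by rw [hw, hT]; ring) z
  refine ⟨algebraMap ℤ_[3] ℚ_[3] (3 * z), ?_⟩
  rw [WeierstrassCurve.map_Ψ₃, eval_map, eval₂_hom, hscale, hz, mul_zero, map_zero]

end IIIstar

end Summit.BirchSwinnertonDyer.BirchSwinnertonDyer.Theorems.SolventPairLowerBound

end
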